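import Mathlib
import Summits.KontsevichZagierPeriods.Zeta5Search.DenomLaw.ShiftedL5Kit
import Summits.KontsevichZagierPeriods.Zeta5Search.DenomLaw.LawA5Depth8
import Summits.KontsevichZagierPeriods.Zeta5Search.DenomLaw.SortedProfileLevels
import HarnessLib

/-!
# ζ(5) search — a COVER KIT for THEOREM L5 at frame depth 8 (`SecondOrder.lawA5_depth8`, `8 − 2M`) in the ALL-PARAMETERS-LONG regime — DENOM-LAW prover-d1 gen 18

HONEST FRAMING: systematic search; no irrationality claim unless certified.  Cell `pub-zeta5`, track «DENOM-LAW», seat `denom-prover-d1`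
gen 18 (`HOME/denom-law/prover-d1/ATTEMPT-18.md` §4).  `p`-adic valuation bookkeeping for the explicit rationals `Cas_j(b)`; nothing about ζ(5);
no model exponent moves; records in print UNMOVED.

THEOREM L5₈ (gen 10's `lawA5_depth8`: the hypotheses of THEOREM L5 with `8 ≤ M` in place of `10 ≤ M`, PLUS «every single-pole class of `b` and of `b + e_j`
has exponent `≥ −M + 4`») was consumed per instance only (`decide` on `lawA5Depth8Guard` for `b` AND for `b + e_j`).  This file is the all-`b` tool for the regime
in which ALL SEVEN PARAMETERS REACH `p` (`p ≤ b_i` for every `i`; gen 10's «X-ray regime»): there the side condition is AUTOMATIC — every residue class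
`{x, x+p, …, x+Lp}` (`x < p ≤ b₀/2`, so `L ≥ 1`) begins below every block and ends above every block, i.e. with two numerator zeros (`netExp = 1`), so a class
with a single pole (order `≤ 6`) has exponent `≥ 1 + 1 − 6 = −4 ≥ −M + 4` for `M ≥ 8` (`neg_four_le_classExp_single_of_long`; it applies to `b + e_j` as
well, whose parameters are `≥` those of `b`).  Hence `lawA5d8_of_cover`: from a class-type cover of `b` passing gen 3's six-clause check `DenomLaw.checkL5` in a
frame `(M, T)` (`M ≥ 8` even, `T` a palindrome), the degree condition `p(M − 4) ≤ 2d(b) + 1` and `p ≤ b_i` for all `i`: `8 − 2M ≤ v_p(Cas_j(b))` for every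
admissible `j` (the clauses for `b + e_j` by typer gen 13's transport `lawA4Classes_shift` / `shapeClause_shift`); `cover_L5d8` is the window wrapper.
MOTIVATION (ATTEMPT-18 §4): on the general-`b` profile `N_p = 16`, branch `{(1,2),…,(1,6)}`, the cell `⌊d/p⌋ = 2` (node `−8`) is THEOREM L5₈ in the frame
`(8,[1,−5,−5,1])` on all 1,823 instances at `p ≤ 11`.  Valuations of explicit rationals; every model exponent these feed is `< 1`.
-/

open Finset

namespace Summit.KontsevichZagierPeriods.Zeta5Search.DenomLaw

open Summit.KontsevichZagierPeriods.Zeta5Search.ClusterValuation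
open Summit.KontsevichZagierPeriods.Zeta5Search.CasoratianValuation (InPolytope shift casoratian)
open Summit.KontsevichZagierPeriods.Zeta5Search.WedgeDictionary (dOf)
open Summit.KontsevichZagierPeriods.Zeta5Search.ClassTypeCover
open Summit.KontsevichZagierPeriods.Zeta5Search.SecondOrder (lawA5_depth8 lawA4Classes_shift shapeClause_shift)
open Summit.KontsevichZagierPeriods.Zeta5Search.SortedProfile (netExp_eq)

variable {p : ℕ}

/-! ## §1 In the all-parameters-long regime a single-pole class has exponent `≥ −4` -/

/-- **A single-pole class has `E ≥ −4` when every parameter reaches `p`.**  For `b` in the polytope with `p ≤ b_i` (`i = 1..7`), `x < p`: the class of `x`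
contains `x` (below every block: `netExp = 1`) and its top point `x + Lp > b₀ − p` (above every block: `netExp = 1`), `L ≥ 1`; its one pole has order `≤ 6` and
every other point `netExp ≥ 0`. -/
theorem neg_four_le_classExp_single_of_long [Fact p.Prime] {b : ℕ → ℤ} (hb : InPolytope b) (hp5 : 5 ≤ p)
    (hlong : ∀ i ∈ range 7, (p : ℤ) ≤ b (i + 1)) {x : ℕ} (hx : x < p) (h1 : classPoleCount b p x = 1) :
    -4 ≤ classExp b p x := by
  have h0 : 0 ≤ b 0 := hb.1.1
  have hp0 : 0 < p := by omega
  have hP1 := hlong 0 (by simp); have hP2 := hlong 1 (by simp); have hP3 := hlong 2 (by simp); have hP4 := hlong 3 (by simp)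
  have hP5 := hlong 4 (by simp); have hP6 := hlong 5 (by simp); have hP7 := hlong 6 (by simp)
  simp only [Nat.reduceAdd] at hP1 hP2 hP3 hP4 hP5 hP6 hP7
  have h27 : 2 * b 7 ≤ b 0 := hb.2.1 6 (by simp)
  have hB : ((b 0).toNat : ℤ) = b 0 := Int.toNat_of_nonneg h0
  have hxn : x ≤ (b 0).toNat := by omega
  -- the top point `t = x + Lp`
  obtain ⟨L, hL, hL'⟩ : ∃ L : ℕ, x + L * p ≤ (b 0).toNat ∧ (b 0).toNat < x + L * p + p := ⟨_, level_bounds b hp0 hxn⟩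
  have hLp : p ≤ L * p := by
    rcases Nat.eq_zero_or_pos L with hL0 | hL1
    · exfalso; rw [hL0, zero_mul, add_zero] at hL'; omega
    · exact Nat.le_mul_of_pos_left p hL1
  -- membership
  have hxS : x ∈ classSet b p x := (mem_classSet_iff b x x).2 ⟨hxn, by simp⟩
  have htS : x + L * p ∈ classSet b p x := (mem_classSet_iff b x (x + L * p)).2 ⟨hL, ⟨(L : ℤ), by push_cast; ring⟩⟩
  have hxt : x ≠ x + L * p := by omega
  set t := x + L * p with htdef
  -- net exponents at the two ends
  have hnx : netExp b x = 1 := by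
    rw [netExp_eq hb, if_neg (show ¬ (b 1 ≤ (x : ℤ) ∧ (x : ℤ) + b 1 ≤ b 0) by omega),
      if_neg (show ¬ (b 2 ≤ (x : ℤ) ∧ (x : ℤ) + b 2 ≤ b 0) by omega), if_neg (show ¬ (b 3 ≤ (x : ℤ) ∧ (x : ℤ) + b 3 ≤ b 0) by omega),
      if_neg (show ¬ (b 4 ≤ (x : ℤ) ∧ (x : ℤ) + b 4 ≤ b 0) by omega), if_neg (show ¬ (b 5 ≤ (x : ℤ) ∧ (x : ℤ) + b 5 ≤ b 0) by omega),
      if_neg (show ¬ (b 6 ≤ (x : ℤ) ∧ (x : ℤ) + b 6 ≤ b 0) by omega), if_neg (show ¬ (b 7 ≤ (x : ℤ) ∧ (x : ℤ) + b 7 ≤ b 0) by omega),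
      if_neg (show ¬ (2 * (x : ℤ) = b 0) by omega)]
    norm_num
  have htZ : b 0 < (t : ℤ) + p := by
    have : (b 0).toNat < t + p := hL'
    omega
  have hnt : netExp b t = 1 := by
    rw [netExp_eq hb, if_neg (show ¬ (b 1 ≤ (t : ℤ) ∧ (t : ℤ) + b 1 ≤ b 0) by omega),
      if_neg (show ¬ (b 2 ≤ (t : ℤ) ∧ (t : ℤ) + b 2 ≤ b 0) by omega), if_neg (show ¬ (b 3 ≤ (t : ℤ) ∧ (t : ℤ) + b 3 ≤ b 0) by omega),
      if_neg (show ¬ (b 4 ≤ (t : ℤ) ∧ (t : ℤ) + b 4 ≤ b 0) by omega), if_neg (show ¬ (b 5 ≤ (t : ℤ) ∧ (t : ℤ) + b 5 ≤ b 0) by omega),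
      if_neg (show ¬ (b 6 ≤ (t : ℤ) ∧ (t : ℤ) + b 6 ≤ b 0) by omega), if_neg (show ¬ (b 7 ≤ (t : ℤ) ∧ (t : ℤ) + b 7 ≤ b 0) by omega),
      if_neg (show ¬ (2 * (t : ℤ) = b 0) by omega)]
    norm_num
  -- the unique pole
  obtain ⟨q, hq⟩ := card_eq_one.1 h1
  have hqmem : q ∈ (classSet b p x).filter (fun s => netExp b s < 0) := by rw [hq]; exact mem_singleton_self q
  obtain ⟨hqS, hqneg⟩ := mem_filter.1 hqmem
  have honly : ∀ s ∈ classSet b p x, s ≠ q → 0 ≤ netExp b s := by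
    intro s hs hne
    by_contra hlt
    have : s ∈ (classSet b p x).filter (fun s => netExp b s < 0) := mem_filter.2 ⟨hs, by omega⟩
    rw [hq, mem_singleton] at this
    exact hne this
  have hxq : x ≠ q := fun h => by rw [← h] at hqneg; omega
  have htq : t ≠ q := fun h => by rw [← h] at hqneg; omega
  -- the sum
  have hsplit := add_sum_erase (classSet b p x) (fun s => netExp b s) hqS
  have hsub : ({x, t} : Finset ℕ) ⊆ (classSet b p x).erase q := by
    intro s hs
    rcases mem_insert.1 hs with rfl | hs
    · exact mem_erase.2 ⟨hxq, hxS⟩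
    · rw [mem_singleton] at hs; subst hs; exact mem_erase.2 ⟨htq, htS⟩
  have hrest : ∑ s ∈ ({x, t} : Finset ℕ), netExp b s ≤ ∑ s ∈ (classSet b p x).erase q, netExp b s :=
    sum_le_sum_of_subset_of_nonneg hsub fun s hs _ => honly s (mem_of_mem_erase hs) (ne_of_mem_erase hs)
  rw [sum_pair hxt, hnx, hnt] at hrest
  have hq6 : -6 ≤ netExp b q := by
    have h7 : blockCount b q ≤ 7 := by unfold blockCount; exact (card_filter_le _ _).trans (by simp)
    unfold netExp; split_ifs <;> omega
  have hsum : -4 ≤ ∑ s ∈ classSet b p x, netExp b s := by rw [← hsplit]; linarith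
  unfold classExp
  split_ifs <;> linarith

/-- The all-parameters-long regime persists under the contiguous shift `b ↦ b + e_j`. -/
theorem long_shift {b : ℕ → ℤ} {j : ℕ} (hlong : ∀ i ∈ range 7, (p : ℤ) ≤ b (i + 1)) :
    ∀ i ∈ range 7, (p : ℤ) ≤ shift b j (i + 1) := by
  intro i hi
  have h := hlong i hi
  unfold shift Function.update
  split_ifs with h'
  · subst h'; linarith
  · exact h

/-! ## §2 THEOREM L5₈ from a cover of `b` alone -/

/-- **THEOREM L5₈ from a cover of `b` alone, all parameters long**: `8 − 2M ≤ v_p(Cas_j(b))` — frame `(M, T)` with `M ≥ 8` even and `T` a palindrome, gen 3's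
six-clause check `checkL5` on the cover, `p(M − 4) ≤ 2d(b) + 1`, and `p ≤ b_i` for every `i` (the clauses for `b + e_j` by transport, the single-pole side
condition for `b` and `b + e_j` by `neg_four_le_classExp_single_of_long`). -/
theorem lawA5d8_of_cover {b : ℕ → ℤ} {j : ℕ} (hb : InPolytope b) (hb' : InPolytope (shift b j)) (hj1 : 1 ≤ j) (hj7 : j ≤ 7)
    (hpr : p.Prime) (hp5 : 5 ≤ p) (hpb : (p : ℤ) ≤ b 0) (hwin : (b 0 + 2 : ℤ) < (p : ℤ) ^ 2) (hlong : ∀ i ∈ range 7, (p : ℤ) ≤ b (i + 1))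
    {TY : List (List ℤ × Bool)} (hcov : Cover b p TY) {M : ℕ} (hM : 8 ≤ M) (hMe : Even M) {T : List ℤ} (hT : T.reverse = T)
    (hchk : checkL5 (decide (¬ (2 : ℤ) ∣ b 0)) TY M T = true) (hdeg : (p : ℤ) * ((M : ℤ) - 4) ≤ 2 * dOf b + 1)
    (hcas : casoratian b j ≠ 0) : (8 : ℤ) - 2 * M ≤ padicValRat p (casoratian b j) := by
  haveI : Fact p.Prime := ⟨hpr⟩
  obtain ⟨hC, hS⟩ := clausesL5_of_cover hcov hchk
  have hC' := lawA4Classes_shift b hb hb' hj1 hj7 hpb (by omega) hC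
  have hS' := shapeClause_shift b hb hb' hj1 hj7 hpb (by omega) hC hS
  have hsing : ∀ y, y < p → classPoleCount b p y = 1 → -(M : ℤ) + 4 ≤ classExp b p y := fun y hy h1 => by
    have := neg_four_le_classExp_single_of_long hb hp5 hlong hy h1; omega
  have hsing' : ∀ y, y < p → classPoleCount (shift b j) p y = 1 → -(M : ℤ) + 4 ≤ classExp (shift b j) p y := fun y hy h1 => by
    have := neg_four_le_classExp_single_of_long hb' hp5 (long_shift hlong) hy h1; omega
  exact lawA5_depth8 b j M T hb hb' ⟨hj1, hj7⟩ hp5 hpb hwin ⟨hM, hMe⟩ hT hC hC' hS hS' hdeg hsing hsing' hcas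

/-- **WINDOW BOUND by THEOREM L5₈ from a cover**: `c ≤ v_p(Cas_j(b))` whenever `c ≤ 8 − 2M`. -/
theorem cover_L5d8 {b : ℕ → ℤ} {j : ℕ} (hb : InPolytope b) (hb' : InPolytope (shift b j)) (hj1 : 1 ≤ j) (hj7 : j ≤ 7)
    (hpr : p.Prime) (hp5 : 5 ≤ p) (hpb : (p : ℤ) ≤ b 0) (hwin : (b 0 + 2 : ℤ) < (p : ℤ) ^ 2) (hlong : ∀ i ∈ range 7, (p : ℤ) ≤ b (i + 1))
    {TY : List (List ℤ × Bool)} (hcov : Cover b p TY) {M : ℕ} (hM : 8 ≤ M) (hMe : Even M) {T : List ℤ} (hT : T.reverse = T)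
    (hchk : checkL5 (decide (¬ (2 : ℤ) ∣ b 0)) TY M T = true) (hdeg : (p : ℤ) * ((M : ℤ) - 4) ≤ 2 * dOf b + 1)
    {c : ℤ} (hc : c ≤ 8 - 2 * (M : ℤ)) (hcas : casoratian b j ≠ 0) : c ≤ padicValRat p (casoratian b j) :=
  le_trans hc (lawA5d8_of_cover hb hb' hj1 hj7 hpr hp5 hpb hwin hlong hcov hM hMe hT hchk hdeg hcas)

end Summit.KontsevichZagierPeriods.Zeta5Search.DenomLaw
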